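/-
Origin: expansion seat `planner-pub-hodgecm-toy2-g2-0`, handover #9 2026-08-18T05:54:39Z (`HOME/pub-hodgecm-toy2-g2/lean/Toy2g2/ToyTrTop.lean`, md5 ced67df3, 169 lines);
landed by the gen-6 packager in gate run 24 as `HodgeCM/Model/Toy/ToyTrTop.lean` (import ^import Toy2g2\.ToyRetrace\b→import HodgeCM.Model.Toy.ToyRetrace ×1).
-/
/-
# `Fact_dimProd` holds and `Fact_trTop` fails in the exterior model — and in every re-tracing of it
(CONSISTENCY seat 2, unit `pub-hodgecm-toy2-g2`; requested by qw8b-g2 2026-08-18T05:35Z)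

`StubTree/Qw8Monomial.lean` (qw8b-g2, run 23) replaces F6 by the two textbook facts
`Fact_dimProd : dim (X × Y) = dim X + dim Y` and `Fact_trTop : ∫_X : H^{2 dim X}(X, ℚ) → ℚ is bijective`.
Their status in the exterior model `toyModelWith D`:

* `fact_dimProd`   — HOLDS (every atom is a CM-type field, so `rk L X` is even and `(a + b)/2 = a/2 + b/2`);
* `not_fact_trTop` — FAILS (`tr = 0`);
* `Retrace.not_fact_trTop` — FAILS in EVERY re-tracing `retrace D tr'` (`ToyRetrace`): the Picard-modular-surface
  placeholder `pmsObj` has `dim = 2` but `H⁴(pmsObj) = ⋀⁴ 0 = 0`, so no trace on it is surjective;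
* `not_fact_trTopCM` / `Retrace.not_trTopCM_of_gysin_surface` — the CM-products-only form `Fact_trTopCM` (qw8b-g2 v2:
  `∫` injective on `H^{2 dim A′}(A′)`) FAILS with `tr = 0` (`⋀^{2d} L ≅ ℚ ≠ 0`) and, in every re-tracing, is REFUTED BY
  M26: `Fact_gysin_surface → ¬ Fact_trTopCM` (M26 forces `tr' = 0` on the CM surface `A_{(ℚ(ζ₅),Φ)}`,
  `Retrace.tr_surface_eq_zero`).  Hence, exactly as for F6, a model of `ModelAxioms ∧ Fact_trTopCM` needs padded objects
  with honest top cohomology — a new model, not merely a new trace.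
-/
import Summits.HodgeConjecture.HodgeCM.StubTree.Qw8Monomial_3
import Summits.HodgeConjecture.HodgeCM.Model.Toy.ToyRetrace

noncomputable section

namespace HodgeCM.Toy

open Literature.AlgebraicGeometry.Motives NumberField
open scoped TensorProduct
open exteriorPower

variable (D : HodgeData)

/-! ### Ranks of the lattices `L X` are even -/

/-- A field carrying a CM type (exactly one of each pair of conjugate embeddings is chosen) has even degree:
complex conjugation is a bijection `Φ → Φᶜ`. -/
lemma Atom.even_finrank (A : Atom) : Even (Module.finrank ℚ A.F) := by
  classical
  let c : (A.F →+* ℂ) → (A.F →+* ℂ) := NumberField.ComplexEmbedding.conjugate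
  have hc : ∀ τ, c (c τ) = τ := fun τ => RingHom.ext fun x => by simp [c]
  let s : Finset (A.F →+* ℂ) := Finset.univ.filter (· ∈ A.Φ)
  have hs : ∀ τ, τ ∈ s ↔ τ ∈ A.Φ := fun τ => by simp [s]
  have h1 : s.card = sᶜ.card := by
    refine Finset.card_bij (fun τ _ => c τ) (fun τ hτ => ?_) (fun τ₁ _ τ₂ _ h => ?_) (fun σ hσ => ?_)
    · rw [Finset.mem_compl, hs]; exact (A.cm τ).mp ((hs τ).mp hτ)
    · simpa [hc] using congrArg c h
    · refine ⟨c σ, ?_, hc σ⟩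
      rw [Finset.mem_compl, hs] at hσ
      rw [hs]
      exact (A.cm (c σ)).mpr (show c (c σ) ∉ A.Φ by rw [hc]; exact hσ)
  refine ⟨s.card, ?_⟩
  rw [← NumberField.Embeddings.card A.F ℂ, ← Finset.card_add_card_compl s, h1]

/-- hence `rk L X = Σ_i [F_i : ℚ]` is even for every object -/
lemma even_finrank_L (X : Obj) : Even (Module.finrank ℚ X.L) := by
  rw [Module.finrank_pi_fintype]
  exact Finset.even_sum _ fun i _ => Atom.even_finrank (X.atom i)

/-- `rk L (X × Y) = rk L X + rk L Y` -/
lemma finrank_L_prod (X Y : Obj) : Module.finrank ℚ (X.prod Y).L = Module.finrank ℚ X.L + Module.finrank ℚ Y.L := by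
  haveI : Module.Free ℚ X.L := Module.Free.of_divisionRing ℚ _
  haveI : Module.Free ℚ Y.L := Module.Free.of_divisionRing ℚ _
  rw [(X.sumEquiv Y).finrank_eq, Module.finrank_prod]

/-- `⋀⁴ L_S ≠ 0` for an object of rank `4` -/
lemma exists_ne_zero_ext4 (S : Obj) (hrk : Module.finrank ℚ S.L = 4) : ∃ z : ↥(⋀[ℚ]^4 S.L), z ≠ 0 := by
  haveI : Module.Free ℚ S.L := Module.Free.of_divisionRing ℚ _
  haveI : Module.Finite ℚ S.L := Module.finite_of_finrank_eq_succ hrk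
  rw [← Module.finrank_pos_iff_exists_ne_zero (R := ℚ), exteriorPower.finrank_eq, hrk]
  decide

/-! ### `Fact_dimProd` holds -/

/-- **`dim (X × Y) = dim X + dim Y`** in the exterior model (any Hodge datum). -/
theorem fact_dimProd : (toyModelWith D).Fact_dimProd := by
  intro X Y
  rw [dim_eq, dim_eq, dim_eq, finrank_L_prod]
  obtain ⟨a, ha⟩ := even_finrank_L X
  obtain ⟨b, hb⟩ := even_finrank_L Y
  rw [ha, hb]
  change (a + a + (b + b)) / 2 + (X.extra + Y.extra) = (a + a) / 2 + X.extra + ((b + b) / 2 + Y.extra)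
  omega

/-! ### `Fact_trTop` fails, with `tr = 0` and with any other trace -/

/-- **`Fact_trTop` fails in the exterior model**: `tr = 0` is not surjective onto `ℚ`. -/
theorem not_fact_trTop : ¬ (toyModelWith D).Fact_trTop := by
  intro h
  obtain ⟨z, hz⟩ := (h pmsObj).2 1
  rw [tr_eq, LinearMap.zero_apply] at hz
  exact zero_ne_one hz

/-- **`Fact_trTopCM` fails in the exterior model**: `tr = 0` is not injective on `H⁴(A_{(ℚ(ζ₅),Φ)}, ℚ) = ⋀⁴ ℚ⁴ ≅ ℚ`. -/
theorem not_fact_trTopCM : ¬ (toyModelWith D).Fact_trTopCM := by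
  intro h
  let Θ : Fin (0 + 1) → CMType Retrace.cyclo5 := fun _ => stdCMType Retrace.cyclo5
  have hrk : Module.finrank ℚ ((toyModelWith D).cmProd Retrace.cyclo5 Θ).L = 4 := by
    change Module.finrank ℚ (cmObj Retrace.cyclo5 (Θ 0)).L = 4
    rw [finrank_L_cmObj, Retrace.cyclo5_finrank]
  have hex : ((toyModelWith D).cmProd Retrace.cyclo5 Θ).extra = 0 := rfl
  have hn : 2 * (toyModelWith D).dim ((toyModelWith D).cmProd Retrace.cyclo5 Θ) = 4 := by rw [dim_eq, hrk, hex]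
  have key : ∀ n, n = 4 →
      ¬ Function.Injective ((toyModelWith D).tr ((toyModelWith D).cmProd Retrace.cyclo5 Θ) n) := by
    rintro n rfl hi
    obtain ⟨z, hz⟩ := exists_ne_zero_ext4 _ hrk
    exact hz (hi (by rw [tr_eq, LinearMap.zero_apply, LinearMap.zero_apply]))
  exact key _ hn (h Retrace.cyclo5 0 Θ)

namespace Retrace

variable (tr' : (X : Obj) → (k : ℕ) → (↥(⋀[ℚ]^k X.L) →ₗ[ℚ] ℚ))

/-- `Fact_dimProd` survives re-tracing (it does not mention the trace). -/
theorem fact_dimProd : (retrace D tr').Fact_dimProd := Toy.fact_dimProd D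

/-- **`Fact_trTop` fails in EVERY re-tracing of the exterior model**: `pmsObj` has `dim = 2` and
`H⁴(pmsObj) = ⋀⁴ 0 = 0`, so no trace functional on it is surjective. -/
theorem not_fact_trTop : ¬ (retrace D tr').Fact_trTop := by
  intro h
  have hdim : 2 * (retrace D tr').dim pmsObj = 4 := by rw [dim_retrace, finrank_L_pmsObj]; rfl
  have hzero : ∀ z : ↥(⋀[ℚ]^4 pmsObj.L), z = 0 := by
    haveI : Module.Free ℚ pmsObj.L := Module.Free.of_divisionRing ℚ _
    rw [← finrank_zero_iff_forall_zero (K := ℚ), exteriorPower.finrank_eq, finrank_L_pmsObj]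
    decide
  have key : ∀ n, n = 4 → ¬ Function.Surjective (tr' pmsObj n) := by
    rintro n rfl hs
    obtain ⟨z, hz⟩ := hs 1
    rw [hzero z, map_zero] at hz
    exact zero_ne_one hz
  exact key _ hdim (h pmsObj).2

/-- **M26 refutes `Fact_trTopCM` in every re-tracing of the exterior model**: `Fact_gysin_surface` forces `tr' = 0`
in degree `4` on the CM surface `A_{(ℚ(ζ₅),Φ)}` (`tr_surface_eq_zero`), where `⋀⁴ L ≅ ℚ ≠ 0`. -/
theorem not_trTopCM_of_gysin_surface (h26 : (retrace D tr').Fact_gysin_surface) : ¬ (retrace D tr').Fact_trTopCM := by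
  intro h
  let Θ : Fin (0 + 1) → CMType cyclo5 := fun _ => stdCMType cyclo5
  have hrk : Module.finrank ℚ ((retrace D tr').cmProd cyclo5 Θ).L = 4 := by
    change Module.finrank ℚ (cmObj cyclo5 (Θ 0)).L = 4
    rw [finrank_L_cmObj, cyclo5_finrank]
  have hex : ((retrace D tr').cmProd cyclo5 Θ).extra = 0 := rfl
  have hn : 2 * (retrace D tr').dim ((retrace D tr').cmProd cyclo5 Θ) = 4 := by rw [dim_retrace, hrk, hex]
  have key : ∀ n, n = 4 → ¬ Function.Injective ((retrace D tr').tr ((retrace D tr').cmProd cyclo5 Θ) n) := by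
    rintro n rfl hi
    obtain ⟨z, hz⟩ := exists_ne_zero_ext4 _ hrk
    refine hz (hi ?_)
    change tr' _ 4 z = tr' _ 4 0
    rw [tr_surface_eq_zero D tr' h26 _ hrk hex z, map_zero]
  exact key _ hn (h cyclo5 0 Θ)

/-- Summary for the §1c table: in every re-tracing of the exterior model `Fact_dimProd` holds and `Fact_trTop` fails;
together with `not_weightDual_of_gysin_surface`, neither F6 nor its textbook replacement `Fact_trTop` has a model on
this object class. -/
theorem dimProd_trTop_profile :
    (retrace D tr').Fact_dimProd ∧ ¬ (retrace D tr').Fact_trTop ∧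
      ((retrace D tr').Fact_gysin_surface → ¬ (retrace D tr').Fact_trTopCM ∧ ¬ (retrace D tr').Fact_weightDual) :=
  ⟨fact_dimProd D tr', not_fact_trTop D tr',
    fun h26 => ⟨not_trTopCM_of_gysin_surface D tr' h26, not_weightDual_of_gysin_surface D tr' h26⟩⟩

/-- In particular no re-tracing of the exterior model is a model of `ModelAxioms ∧ Fact_trTopCM`. -/
theorem not_modelAxioms_and_trTopCM : ¬ ((retrace D tr').ModelAxioms ∧ (retrace D tr').Fact_trTopCM) :=
  fun h => not_trTopCM_of_gysin_surface D tr' h.1.gysin_surface h.2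

end Retrace

/-- The exterior model itself: `Fact_dimProd` holds, `Fact_trTop` and `Fact_trTopCM` fail. -/
theorem dimProd_trTop_profile :
    (toyModelWith D).Fact_dimProd ∧ ¬ (toyModelWith D).Fact_trTop ∧ ¬ (toyModelWith D).Fact_trTopCM :=
  ⟨fact_dimProd D, not_fact_trTop D, not_fact_trTopCM D⟩

end HodgeCM.Toy
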